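import Summits.Langlands.Langlands.Theses.QuarterDeficit1951
import Summits.Langlands.Langlands.Theorems.CensusDeficit1951.Negative.CensusDeficit1951FalseOfTwoWindowMaassCuspFormsAt1951
import Summits.Langlands.Langlands.Theorems.CensusDeficit1951.Negative.CensusDeficit1951FalseOfOddWindowCertificate

/-!
# STRATEGY-CENSUS s3 — typed companions (crux `CensusDeficit1951`, stmt-Langlands-17933)

Crux-strategist `planner-cstrat-stmt-Langlands-17933-0`, 2026-08-17. Scratch file accompanying
`Cruxes/CensusDeficit1951/STRATEGY-CENSUS.md` (s3). Nothing here is a line or a stub; it types the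
`## Strengthen` entry S⁺_vac and proves the two arrows quoted there:

* `censusDeficit1951_of_vacancy : VacancyCensus1951 → CensusDeficit1951` — the rigid (Hecke-free,
  `U = 0`) strengthening implies the crux;
* `not_vacancyCensus1951_of_windowForm : WindowMaassCuspFormAt1951 → ¬ VacancyCensus1951` — and is
  refuted by ONE Laplace-only window cusp form for one order-5 `χ` (the shape of the parent crux's
  CERT-B output read through the landed dictionary), i.e. by strictly LESS than what refutes the crux
  itself (`OddWindowCertificate`, six Hecke boxes; `CensusDeficit1951_false_of_OddWindowCertificate`,
  p161038). This is the precise sense in which "rigidity buys nothing for THIS step": it cheapens the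
  refutation of S⁺, not of D.
* `not_censusDeficit1951_iff_forall` — bookkeeping: `¬ D` is an existential over `χ` of a universal
  over transcripts (the shape every negation line must instantiate at ONE character).
-/

set_option linter.dupNamespace false

namespace Summit.Langlands.Langlands.Cruxes.CensusDeficit1951.CensusS3

open Literature.NumberTheory.Automorphic
open Summit.Langlands.Langlands.Theses.QuarterDeficit1951
open Summit.Langlands.Langlands.Theorems.CensusDeficit1951.Negative (exists_line_of_cuspForm window_cast)

/-- **S⁺_vac — the vacancy census** (strategist s1's S⁺₁, typed over the landed format): every order-5
`χ mod 1951` carries a certified transcript with the crux's bounds whose upper count is `0`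
(empty window `|λ − 1/4| ≤ window`, `window ≥ 1/100`; Hecke-free: `U = ⌊m1hi/hlo⌋` uses the `n = 1`
trace only). [strategist census S⁺] -/
def VacancyCensus1951 : Prop :=
  ∀ χ : DirichletCharacter ℂ 1951, orderOf χ = 5 →
    ∃ c : MaassHeckeTraceCensus, (1 / 100 : ℚ) ≤ c.window ∧ (1 / 100 : ℚ) ≤ c.fpTol ∧
      (∀ p ∈ c.fpPrimes, p ∈ ({2, 3, 5, 7, 11, 13} : Finset ℕ)) ∧
      CertifiedMaassHeckeTraceCensus 1951 χ c ∧ c.upperCount = 0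

/-- **One window Maass cusp form at conductor 1951** (Laplace-only, no parity, no Hecke data): for some
order-5 `χ` a non-zero `IsMaassCuspFormOn 1951 χ u λ` with `|λ − 1/4| ≤ 1/100`. Numerically: the sighted
odd `r = 0` newform in any of the four spaces; certificate = the parent crux's CERT-B (Δ-only odd
quasimode inequality) plus the landed `isMaassCuspFormOn_of_two_cusps` / `stub_oddConstantTerms`.
A CONSTRUCTION hypothesis of verdict class computation. [strategist census S⁺] -/
def WindowMaassCuspFormAt1951 : Prop :=
  ∃ χ : DirichletCharacter ℂ 1951, orderOf χ = 5 ∧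
    ∃ (u : UpperHalfPlane → ℂ) (lam : ℝ), IsMaassCuspFormOn 1951 χ u lam ∧ (∃ z, u z ≠ 0) ∧
      |lam - 1 / 4| ≤ 1 / 100

/-- **S⁺_vac ⇒ D**: `U = 0` together with the well-formedness conjunct of `CertifiedMaassHeckeTraceCensus`
makes `certifiesDeficit = true`. [strategist census S⁺] -/
theorem censusDeficit1951_of_vacancy (h : VacancyCensus1951) : CensusDeficit1951 := by
  intro χ hχ
  obtain ⟨c, hw, ht, hp, hc, hU⟩ := h χ hχ
  refine ⟨c, hw, ht, hp, hc, ?_⟩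
  have hwf : c.wellFormed = true := hc.2.1
  unfold MaassHeckeTraceCensus.certifiesDeficit
  simp [hwf, hU]

/-- **One window form refutes S⁺_vac** (`not_inWindow_of_upperCount_eq_zero` + completeness): strictly
weaker input than the crux's own refutation (`OddWindowCertificate`, six Hecke boxes). [strategist census S⁺] -/
theorem not_vacancyCensus1951_of_windowForm (H : WindowMaassCuspFormAt1951) : ¬ VacancyCensus1951 := by
  intro hV
  obtain ⟨χ, hχ, u, lam, hu, hne, hwin⟩ := H
  obtain ⟨c, hw, -, -, hc, hU⟩ := hV χ hχ
  unfold CertifiedMaassHeckeTraceCensus at hc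
  obtain ⟨-, hwf, J, d, hJ, hE⟩ := hc
  have hu0 : u ≠ 0 := by
    obtain ⟨z, hz⟩ := hne
    exact fun h => hz (by simp [h])
  obtain ⟨j, hj⟩ := exists_line_of_cuspForm hJ hu hu0
  have hwin' : c.inWindow (d j).lam := by
    rw [MaassHeckeTraceCensus.inWindow, hj]; exact hwin.trans (window_cast hw)
  exact MaassHeckeTraceCensus.not_inWindow_of_upperCount_eq_zero hJ hE hwf hU j hwin'

/-- **Shape of every negation line**: `¬ D` is "some order-5 `χ` all of whose bounded certified
transcripts have verdict `false`". [folklore] -/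
theorem not_censusDeficit1951_iff_forall :
    ¬ CensusDeficit1951 ↔ ∃ χ : DirichletCharacter ℂ 1951, orderOf χ = 5 ∧
      ∀ c : MaassHeckeTraceCensus, (1 / 100 : ℚ) ≤ c.window → (1 / 100 : ℚ) ≤ c.fpTol →
        (∀ p ∈ c.fpPrimes, p ∈ ({2, 3, 5, 7, 11, 13} : Finset ℕ)) →
        CertifiedMaassHeckeTraceCensus 1951 χ c → c.certifiesDeficit = false := by
  unfold CensusDeficit1951
  constructor
  · intro h
    push Not at h
    obtain ⟨χ, hχ, hall⟩ := h
    refine ⟨χ, hχ, fun c h1 h2 h3 h4 => ?_⟩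
    have := hall c h1 h2 h3 h4
    simpa using this
  · rintro ⟨χ, hχ, hall⟩ h
    obtain ⟨c, h1, h2, h3, h4, h5⟩ := h χ hχ
    have := hall c h1 h2 h3 h4
    rw [h5] at this
    exact Bool.noConfusion this

/-- The OddWindowCertificate refutation of record, re-exported BY NAME (p161038): the decisive input of
every negation line for this crux. [folklore] -/
example (H : Summit.Langlands.Langlands.Theorems.QuarterFingerprintDeficit.Negative.OddWindowCertificate) :
    ¬ CensusDeficit1951 :=
  Summit.Langlands.Langlands.Theorems.CensusDeficit1951.Negative.CensusDeficit1951_false_of_OddWindowCertificate H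

end Summit.Langlands.Langlands.Cruxes.CensusDeficit1951.CensusS3
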